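import Summits.BirchSwinnertonDyer.BirchSwinnertonDyer.Theorems.BiquadraticEisensteinDescentControlCMInertBadAdmOtherAdditiveCount
import Summits.BirchSwinnertonDyer.BirchSwinnertonDyer.Theorems.EisensteinPrimesBSDpOnCellCLogSymmetry
import Summits.BirchSwinnertonDyer.BirchSwinnertonDyer.Theses.BiquadraticEisensteinDescent
import Summits.BirchSwinnertonDyer.Rank1Residual.X11b.BDPRouteOnTreeStepL
import Summits.BirchSwinnertonDyer.Rank1Residual.X12.CMIrreducible
import Literature.NumberTheory.EllipticCurves.ComplexMultiplicationNotSemistable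
import HarnessLib

/-!
# Route `BiquadraticEisensteinDescent`, crux C′ `ControlCMInertBadAdmOther` (stmt-BirchSwinnertonDyer-20454):
# the crux modulo Gross–Zagier + Kolyvagin + modularity — file 2 (the CM-inert-bad specialisation)

Seat `bsd-wall-bed-p3` (prover, cell `bsd-wall`, rung W-ALL row CornerF / K12i). Theorems only; no
definition, no named fact, no `sorry`. Sequel of `…ControlCMInertBadAdmOtherAdditiveCount.lean`
(the additive-prime Selmer count and control count, reduction-type-free kernel).

## Content

* §3 `additiveControlLe_of_rankOne` — the UPPER half of anticyclotomic control at an ADDITIVE prime,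
  at one frame `(κ, γ, 𝔭)` with the logarithm at the strict prime: `X_𝔭(E_K[p^∞])` is `Λ`-torsion with
  `ord_p f(0) = n ≤ ord_p #Ш(E/K)[p^∞] + 2·(ord_p log_{ω,𝔭} P − ord_p[E(K):ℤP]) + ord_p ∏_{w∣N⁺} c_w`,
  GIVEN `rank_ℤ E(K) = 1`, `Ш(E/K)` finite, `P` non-torsion, `E(K)[p] = 0` (file 1, §1 + §2).
* §4 the crux C′ of the route, i.e. `Theses.BiquadraticEisensteinDescent.ControlCMInertBadAdmOther`
  (`X_ac` STRICT at the OTHER prime `𝔭′`, log at `embAt K p 𝔭`), in two closability shapes: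
  - `controlCMInertBadAdmOther_of_rankOne` — the crux's binders VERBATIM with three extra antecedents
    `(W.baseChange K).mordellWeilRank = 1 → (W.baseChange K).ShaFinite → ¬ IsOfFinAddOrder P →` inserted
    after `¬ (p : ℤ) ∣ Dt.c →` (fact-free);
  - **`controlCMInertBadAdmOther_of_GZK`** —
    `(∀ N W K, gross_zagier N W K) → (∀ N W K, kolyvagin N W K) → hasEntireLFunction_rat → ControlCMInertBadAdmOther`,
    the three antecedents being conjuncts 1, 2, 5 of the route's `PublishedInputsBiquadratic` (so the
    route's `closes` discharges them).
  The CM inputs are tree theorems: `Addv W p` (bad and never multiplicative, `not_mult_of_hasCM`),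
  `E(K)[p] = 0` (`X12.irr_of_not_cmRamified` — `p` is inert, hence unramified, in the CM field — and
  `Transvection.forall_torsion_eq_zero_of_irr` over the quadratic `K`), `p = 𝔭𝔭′` split (Heegner
  hypothesis at `p ∣ N`), the degree-one data of `𝔭′`, and the log-embedding symmetry
  `ord_p log_{𝔭′} P = ord_p log_𝔭 P` for a rank-one `E(K)` (`LogSymmetry.padicLogOrd_eq_of_finrank_eq_two`,
  bsd-eis cell; underlying `padicLogOrd_comp_eq_of_rank_one`, b2b cell). NOT used: the crux's
  hypotheses `4 < |d_K|`, the biquadratic class-number condition, `p ∤ c(Dt)` — the upper half of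
  control needs none of them (they serve (E)/(W) of the route).

HONEST STATUS. `ControlCMInertBadAdmOther` AS TYPED is not closed by this file: its conclusion at a
torsion `P` / infinite `Ш` is a junk branch that only Gross–Zagier–Kolyvagin excludes (vet-utd g0
note on 20454, 2026-08-27T09:18Z). Per the cell's closability protocol (cm g4, 09:17Z) the planner
restates the crux ONCE with the fact antecedents; `controlCMInertBadAdmOther_of_GZK` (or `_of_rankOne`)
then closes the restated item by `exact`. Nothing booked; no label moves.

References: [JetchevSkinnerWan2017] Thm. 3.3.1, §7.4.1 (arXiv:1512.06894 pp. 11, 30); [GreenbergLNM1716]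
§3 Lemma 3.3, §4 Lemma 4.2; [Castella2018] Thm. 2.3; [Gross1991] (1.1), Thm. 1.3; [Kolyvagin1990] Thm. A;
[Mazur1978] §6 Prop. 6.3 (1); [SilvermanATAEC1994] Thm. II.6.4.
-/

noncomputable section

open scoped Classical

open WeierstrassCurve NumberField IsDedekindDomain Field
open Literature.NumberTheory.EllipticCurves Literature.NumberTheory.EllipticCurves.GreenbergSelmer
  Literature.NumberTheory.EllipticCurves.ModularForms
  Literature.NumberTheory.EllipticCurves.Rank1Residual
  Literature.NumberTheory.EllipticCurves.Rank1Residual.Typed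
  Literature.NumberTheory.QuadraticFields.Quadratic
  Literature.NumberTheory.GaloisRepresentations Literature.NumberTheory.GaloisCohomology
  Summit.BirchSwinnertonDyer.Rank1Residual
  Summit.BirchSwinnertonDyer.Rank1Residual.X11b
  Summit.BirchSwinnertonDyer.Rank1Residual.X11b.AcSelmer
  Summit.BirchSwinnertonDyer.Rank1Residual.X11b.LocBridge
  Summit.BirchSwinnertonDyer.BirchSwinnertonDyer.Theorems.BiquadraticEisensteinDescentControlCMInertBadAdmOtherAdditiveCount

set_option linter.dupNamespace false

namespace Summit.BirchSwinnertonDyer.BirchSwinnertonDyer.Theorems.BiquadraticEisensteinDescentControlCMInertBadAdmOther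

/-! ## §3. The additive control inequality at one frame (log at the strict prime) -/

section Frame

/-- **Anticyclotomic control, UPPER half, at an ADDITIVE prime — one frame, log at the strict prime.**
For a globally minimal elliptic `W/ℚ` with additive reduction at `p`, an imaginary quadratic `K` with
`p` split, `E(K)[p] = 0`, `rank_ℤ E(K) = 1`, `Ш(E/K)` finite, a non-torsion `P ∈ E(K)`, an
anticyclotomic `ℤ_p`-extension `κ` with topological generator `γ` and a degree-one prime `𝔭 ∋ p`:
`X_𝔭(E_K[p^∞])` (strict at `𝔭`) is `Λ`-torsion, `Ch = (f)` with `f(0) ≠ 0`, and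
`ord_p f(0) ≤ ord_p #Ш(E/K)[p^∞] + 2·(ord_p log_{ω,𝔭} P − ord_p[E(K):ℤP]) + ord_p ∏_{w∣N⁺} c_w(E/K)`.
File 1, §1 + §2. [cite: JetchevSkinnerWan2017, Thm. 3.3.1 and §7.4.1 (arXiv:1512.06894 pp. 11, 30)]
[cite: GreenbergLNM1716, §3 Lemma 3.3, §4 Lemma 4.2] [cite: Castella2018, Thm. 2.3 (arXiv:1704.06608 p. 5)] -/
theorem additiveControlLe_of_rankOne (W : WeierstrassCurve ℚ) [W.IsElliptic]
    [W.IsGloballyMinimal] (p : ℕ) [Fact p.Prime] (K : Type) [Field K] [NumberField K]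
    (hadd : Addv W p) (hK : IsImaginaryQuadratic K) (hsplit : SplitsIn K p)
    (hivK : ∀ x : (W.baseChange K).toAffine.Point, p • x = 0 → x = 0)
    (hrank : (W.baseChange K).mordellWeilRank = 1) (hSha : (W.baseChange K).ShaFinite)
    (P : (W.baseChange K).toAffine.Point) (hPinf : ¬ IsOfFinAddOrder P)
    (κ : ZpExtension K p) (hκ : κ.IsAnticyclotomic)
    (γ : Field.absoluteGaloisGroup K) [Fact (κ.IsTopGenerator γ)]
    (𝔭 : HeightOneSpectrum (𝓞 K)) (h𝔭 : ((p : ℕ) : 𝓞 K) ∈ 𝔭.asIdeal)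
    (he : 𝔭.asIdeal.ramificationIdx (𝓞 ℚ) = 1) (hf : 𝔭.asIdeal.inertiaDeg (𝓞 ℚ) = 1) :
    ∃ n : ℕ, XAc.HasCharValuationAt (W.baseChange K) p κ 𝔭 ∅ γ n ∧
      (n : ℤ) ≤
        (padicValNat p (Nat.card (AddCommGroup.primaryComponent (W.baseChange K).sha p)) : ℤ) +
        2 * (X11b.padicLogOrd W p (embAt K p 𝔭 h𝔭 he hf) P -
          (padicValNat p (AddSubgroup.zmultiples P).index : ℤ)) +
          padicValNat p (tamagawaProductSplit W K) := by
  haveI : IsTotallyComplex K := hK.2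
  have hpN : p ∣ W.conductorNorm ℤ :=
    (W.dvd_conductorNorm_iff_not_hasGoodReductionAtPrime p).mpr hadd.1
  obtain ⟨hfinSel, a, ha, hale⟩ := additiveSelmerCardBoundTorsion_of_rankOne W p K hadd hK hsplit
    hivK hrank hSha P hPinf 𝔭 h𝔭 he hf
  haveI := hfinSel
  obtain ⟨n, hn, hnle⟩ := exists_hasCharValuationAt_le_of_selmerCardBound_torsion (γ := γ) hK.1 hκ
    h𝔭 he hf hsplit hpN ha
  refine ⟨n, hn, ?_⟩
  have hZ : (n : ℤ) + padicValNat p (tamagawaProductAbove W K p) ≤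
      a + padicValNat p (tamagawaProductSplit W K) := by exact_mod_cast hnle
  linarith

end Frame

/-! ## §4. The crux C′ of the route modulo Gross–Zagier, Kolyvagin, modularity -/

section Crux

open Summit.BirchSwinnertonDyer.BirchSwinnertonDyer.Theses.BiquadraticEisensteinDescent

/-- **Crux C′ `ControlCMInertBadAdmOther`, fact-free closability shape.** The crux's binders VERBATIM,
with three antecedents `(W.baseChange K).mordellWeilRank = 1 → (W.baseChange K).ShaFinite →
¬ IsOfFinAddOrder P →` inserted after `¬ (p : ℤ) ∣ Dt.c →`: for a CM curve `W/ℚ` of analytic rank one,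
`p ≥ 5` inert in the CM field and bad (hence ADDITIVE: `not_mult_of_hasCM`; `E[p]` irreducible:
`X12.irr_of_not_cmRamified`, so `E(K)[p] = 0` over the quadratic `K`), `K` imaginary quadratic with the
Heegner hypothesis (so `p = 𝔭𝔭′` splits), at every anticyclotomic `(κ, γ)`, degree-one `𝔭 ∋ p` and the
other prime `𝔭′ ∋ p`: `X_{𝔭′}(E_K[p^∞])` has `ord_p f(0) = n ≤ ord_p #Ш(E/K)[p^∞] + 2·(ord_p log_{ω,𝔭} P −
ord_p[E(K):ℤP]) + ord_p ∏_{w∣N⁺} c_w` — §3 at the strict prime `𝔭′` and the log-embedding symmetry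
`ord_p log_{𝔭′} P = ord_p log_𝔭 P` (rank one). The hypotheses `4 < |d_K|`, the class-number
condition, `P = y_K`, `p ∤ c(Dt)`, `L(E^{d_K},1) ≠ 0` are not used.
[cite: JetchevSkinnerWan2017, Thm. 3.3.1 and §7.4.1 (arXiv:1512.06894 pp. 11, 30)]
[cite: GreenbergLNM1716, §3 Lemma 3.3, §4 Lemma 4.2] [cite: Mazur1978, §6 Prop. 6.3 (1) (p. 153)]
[cite: SilvermanATAEC1994, Thm. II.6.4 (PDF p. 148)] -/
theorem controlCMInertBadAdmOther_of_rankOne :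
    ∀ (W : WeierstrassCurve ℚ) [W.IsElliptic] [W.IsGloballyMinimal] (p : ℕ) [Fact p.Prime]
      [NeZero (W.conductorNorm ℤ)] (K : Type) [Field K] [NumberField K]
      (Dt : ModularParametrizationData W (W.conductorNorm ℤ))
      (H : HeegnerDatum (W.conductorNorm ℤ) (NumberField.discr K)) (ι : K →+* ℂ)
      (P : (W.baseChange K).toAffine.Point),
      W.HasCM → W.analyticRank = 1 → 5 ≤ p → CMInert W p → ¬ Good W p →
      IsImaginaryQuadratic K → SatisfiesHeegnerHypothesis (W.conductorNorm ℤ) K →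
      4 < (NumberField.discr K).natAbs →
      (∀ (L : Type) [Field L] [NumberField L], Module.finrank ℚ L = 4 →
        (∃ x : L, x ^ 2 = ((cmFieldDiscrOfJ W.j : ℤ) : L)) →
        (∃ y : L, y ^ 2 = ((NumberField.discr K : ℤ) : L)) → ¬ p ∣ NumberField.classNumber L) →
      WeierstrassCurve.Affine.Point.map ι.toRatAlgHom P = heegnerPointComplex Dt H →
      ¬ (p : ℤ) ∣ Dt.c →
      (W.baseChange K).mordellWeilRank = 1 → (W.baseChange K).ShaFinite → ¬ IsOfFinAddOrder P →
      (W.quadraticTwist (NumberField.discr K : ℚ)).entireLFunction 1 ≠ 0 →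
      ∀ (κ : ZpExtension K p), κ.IsAnticyclotomic →
        ∀ (γ : Field.absoluteGaloisGroup K) [Fact (κ.IsTopGenerator γ)]
          (𝔭 : HeightOneSpectrum (𝓞 K)) (h𝔭 : ((p : ℕ) : 𝓞 K) ∈ 𝔭.asIdeal)
          (he : 𝔭.asIdeal.ramificationIdx (𝓞 ℚ) = 1) (hf : 𝔭.asIdeal.inertiaDeg (𝓞 ℚ) = 1)
          (𝔭' : HeightOneSpectrum (𝓞 K)) (_ : ((p : ℕ) : 𝓞 K) ∈ 𝔭'.asIdeal) (_ : 𝔭' ≠ 𝔭),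
          ∃ n : ℕ, XAc.HasCharValuationAt (W.baseChange K) p κ 𝔭' ∅ γ n ∧
            (n : ℤ) ≤
              (padicValNat p (Nat.card (AddCommGroup.primaryComponent (W.baseChange K).sha p)) : ℤ) +
              2 * (X11b.padicLogOrd W p (embAt K p 𝔭 h𝔭 he hf) P -
                (padicValNat p (AddSubgroup.zmultiples P).index : ℤ)) +
              padicValNat p (tamagawaProductSplit W K) := by
  intro W _ _ p _ _ K _ _ Dt H ι P hCM _hr hp5 hin hbad hK hHN _hd4 _hadm _hP _hc hrank hSha hPinf
    _hLt κ hκ γ _ 𝔭 h𝔭 he hf 𝔭' h𝔭' _hne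
  have hp2 : p ≠ 2 := by omega
  -- the CM-inert-bad inputs: additive at `p`, `E(K)[p] = 0`, `p` split in `K`
  have hadd : Addv W p := ⟨hbad, not_mult_of_hasCM W hCM p⟩
  have hivK : ∀ x : (W.baseChange K).toAffine.Point, p • x = 0 → x = 0 :=
    Transvection.forall_torsion_eq_zero_of_irr W p (X12.irr_of_not_cmRamified W p hp2 hin.1) K hK.1
  have hpN : p ∣ W.conductorNorm ℤ := (W.dvd_conductorNorm_iff_not_hasGoodReductionAtPrime p).mpr hbad
  have hsplit : SplitsIn K p := hHN p Fact.out hpN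
  obtain ⟨he', hf'⟩ := degreeOne_of_splitsIn hK.1 hsplit h𝔭'
  -- §3 at the strict prime `𝔭′`, then the log read at `𝔭`
  obtain ⟨n, hn, hle⟩ := additiveControlLe_of_rankOne W p K hadd hK hsplit hivK hrank hSha P hPinf κ hκ
    γ 𝔭' h𝔭' he' hf'
  refine ⟨n, hn, ?_⟩
  rw [LogSymmetry.padicLogOrd_eq_of_finrank_eq_two W p hp2 hK.1 (embAt K p 𝔭 h𝔭 he hf)
    (embAt K p 𝔭' h𝔭' he' hf') hrank P hPinf] at hle
  exact hle

/-- **Crux C′ `ControlCMInertBadAdmOther` modulo Gross–Zagier, Kolyvagin and modularity** — the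
conjuncts 1, 2 and 5 of the route's `PublishedInputsBiquadratic`, stated FIRST:
`(∀ N W K, gross_zagier N W K) → (∀ N W K, kolyvagin N W K) → hasEntireLFunction_rat →
ControlCMInertBadAdmOther`. At the crux's data the Heegner point `P` is non-torsion
(`ord_{s=1} L(E,s) = 1`, `L(E^{d_K},1) ≠ 0`, Gross–Zagier: `X11b.not_isOfFinAddOrder_of_heegner_of_analyticRank_eq_one`),
hence `rank_ℤ E(K) = 1` and `Ш(E/K)` finite (Kolyvagin), and `controlCMInertBadAdmOther_of_rankOne`
applies. This is the route's C′ in the closability protocol's shape "`<facts> → <statement verbatim>`".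
[cite: Gross1991, (1.1) and Thm. 1.3] [cite: Kolyvagin1990, Thm. A]
[cite: JetchevSkinnerWan2017, Thm. 3.3.1 and §7.4.1 (arXiv:1512.06894 pp. 11, 30)] -/
theorem controlCMInertBadAdmOther_of_GZK
    (hGZ : ∀ (N : ℕ) [NeZero N] (W : WeierstrassCurve ℚ) (K : Type) [Field K] [NumberField K],
      gross_zagier N W K)
    (hKo : ∀ (N : ℕ) [NeZero N] (W : WeierstrassCurve ℚ) (K : Type) [Field K] [NumberField K],
      kolyvagin N W K)
    (hmod : hasEntireLFunction_rat) :
    ControlCMInertBadAdmOther := by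
  intro W _ _ p _ _ K _ _ Dt H ι P hCM hr hp5 hin hbad hK hHN hd4 hadm hP hc hLt κ hκ γ _ 𝔭 h𝔭 he hf
    𝔭' h𝔭' hne
  have hPinf : ¬ IsOfFinAddOrder P :=
    not_isOfFinAddOrder_of_heegner_of_analyticRank_eq_one W (W.conductorNorm ℤ) K Dt H ι P
      (hGZ _ W K) hmod hr hK hHN hLt hP
  obtain ⟨hrank, hSha⟩ := hKo (W.conductorNorm ℤ) W K hK hHN ⟨Dt, H, ι, hP⟩ hPinf
  exact controlCMInertBadAdmOther_of_rankOne W p K Dt H ι P hCM hr hp5 hin hbad hK hHN hd4 hadm hP hc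
    hrank hSha hPinf hLt κ hκ γ 𝔭 h𝔭 he hf 𝔭' h𝔭' hne

end Crux

end Summit.BirchSwinnertonDyer.BirchSwinnertonDyer.Theorems.BiquadraticEisensteinDescentControlCMInertBadAdmOther

end
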